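import Summits.QuantumFields.YangMills.Theorems.BalabanUVNodesPortS1ZkCoarea
import Summits.QuantumFields.YangMills.Theorems.BalabanUVNodesK0RecordFormatNamesFluctD

/-!
# NODE O port PT-A — `recordZkCan` (DEF-1 ed.15d ✓p805617, `…K0RecordFormatNamesFluctD`) IS BASIS-FREE AT THE RECORD's NAMES: the Gram-normalised (1.4) Gaussian over the arbitrary kernel
# basis `recordCop` equals the same expression over ANY other basis `recordCop·A`, and equals the COAREA form `(recordJacQ)⁻¹ · Z14 S N` for any orthonormal basis `N` of the same span —
# the record instances of `…PortS1ZkCoarea.sqrt_gram_mul_Z14_basis_change` ∕ `…_of_orthonormal` (CRIT-1 Z-NORM ruling 02:19:22Z, DICTIONARY §D-17.Z⁵)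

Cell `ym-nodeO-ideate`, porter seat `ymgap-nodeO-port-PTA-1` (gen 3); `--supports stmt-QuantumFields-27930` (helper).  [I] = [Balaban1987RG1].  (The GRAPH form `|det A₁|⁻¹·Z14 S C_graph` =
`zCan_eq_zLoc` at the record waits for the reindexing `FluctIdx ≃ CoarseIdx ⊕ NonB0` and `A₂ := recordLQtOff` — DEF-1's offered names.)
HONEST FRAMING.  Linear algebra at the record's names; positivity of `Cᵀ S C` is a HYPOTHESIS (NODE O's [B9] Thm 3.11 at the record), nothing of Bałaban asserted; 27930 OPEN; K0⁷ NOT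
closed; NODE O 0∕1; COUNT 8∕28 · K 1∕4 UNMOVED; finite `𝕋⁴_{L^K}` at fixed ε — NOT continuum ∕ OS ∕ Clay; **the Yang–Mills mass gap is NOT proved by any of this.**  No `sorry`∕`def`∕`instance`.
-/

noncomputable section

namespace Summit.QuantumFields.YangMills.Theorems.BalabanUVNodesPortS1

open Summit.QuantumFields.YangMills.Theorems.K0RecordFormatNames
open Literature.MathematicalPhysics.QuantumFieldTheory.Balaban1983to89
open Literature.MathematicalPhysics.QuantumFieldTheory.Balaban1983to89.Node00
open Literature.MathematicalPhysics.QuantumFieldTheory.Balaban1983to89.T4Continuum (T4Family)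
open _root_.Matrix

variable (F : T4Family)

/-- ★ **`recordZkCan` DOES NOT DEPEND ON THE KERNEL BASIS**: replacing `recordCop` by `recordCop · A` (`A` invertible) in the Gram-normalised Gaussian gives the same number (positivity of
`Copᵀ S Cop` assumed). [cite: Balaban1987RG1, (1.4) p.260, p.268] -/
theorem recordZkCan_eq_of_basis_change (k K : ℕ) (εbg : ℝ) (U : GaugeField (F.P K) 0 (SU 2)) (Vk : GaugeField (F.P K) k (SU 2))
    (hopLin : (PBond (F.P K) (k + 1) → MatA 2) →ₗ[ℝ] (FluctIdx F k K → ℝ))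
    (A : Matrix (Fin (Module.finrank ℝ (fluctKer F k K Vk))) (Fin (Module.finrank ℝ (fluctKer F k K Vk))) ℝ) (hA : IsUnit A.det)
    (hpos : ((recordCop F k K Vk)ᵀ * recordS F k K εbg U Vk hopLin * recordCop F k K Vk).PosDef) :
    recordZkCan F k K εbg U Vk hopLin =
      (recordJacQ F k K Vk)⁻¹ * (Real.sqrt ((recordCop F k K Vk * A)ᵀ * (recordCop F k K Vk * A)).det *
        B12Eq15QuadraticForm.Z14 (recordS F k K εbg U Vk hopLin) (recordCop F k K Vk * A)) := by
  rw [recordZkCan, recordGramC, mul_assoc, sqrt_gram_mul_Z14_basis_change _ _ A hpos hA]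

/-- ★ **`recordZkCan` IS THE COAREA FORM**: for any `N` with orthonormal columns spanning the same kernel (`N = recordCop · A`, `A` invertible, `NᵀN = 1`),
`recordZkCan = (recordJacQ)⁻¹ · Z14 S N` — CRIT-1's §D-17.Z″ reading. [cite: Balaban1987RG1, (1.4) p.260, p.268] -/
theorem recordZkCan_eq_coarea_of_orthonormal (k K : ℕ) (εbg : ℝ) (U : GaugeField (F.P K) 0 (SU 2)) (Vk : GaugeField (F.P K) k (SU 2))
    (hopLin : (PBond (F.P K) (k + 1) → MatA 2) →ₗ[ℝ] (FluctIdx F k K → ℝ))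
    (A : Matrix (Fin (Module.finrank ℝ (fluctKer F k K Vk))) (Fin (Module.finrank ℝ (fluctKer F k K Vk))) ℝ) (hA : IsUnit A.det)
    (N : Matrix (FluctIdx F k K) (Fin (Module.finrank ℝ (fluctKer F k K Vk))) ℝ) (hN : N = recordCop F k K Vk * A) (hNN : Nᵀ * N = 1)
    (hpos : ((recordCop F k K Vk)ᵀ * recordS F k K εbg U Vk hopLin * recordCop F k K Vk).PosDef) :
    recordZkCan F k K εbg U Vk hopLin = (recordJacQ F k K Vk)⁻¹ * B12Eq15QuadraticForm.Z14 (recordS F k K εbg U Vk hopLin) N := by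
  rw [recordZkCan_eq_of_basis_change F k K εbg U Vk hopLin A hA hpos, ← hN, sqrt_gram_mul_Z14_of_orthonormal _ N hNN]

/-- `log Z^{(k)}` canonical, coarea reading: `recordLogZkCan = log((recordJacQ)⁻¹ · Z14 S N)` under the same hypotheses. [cite: Balaban1987RG1, (1.3)–(1.4) p.260 (bookkeeping)] -/
theorem recordLogZkCan_eq_coarea_of_orthonormal (k K : ℕ) (εbg : ℝ) (U : GaugeField (F.P K) 0 (SU 2)) (Vk : GaugeField (F.P K) k (SU 2))
    (hopLin : (PBond (F.P K) (k + 1) → MatA 2) →ₗ[ℝ] (FluctIdx F k K → ℝ))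
    (A : Matrix (Fin (Module.finrank ℝ (fluctKer F k K Vk))) (Fin (Module.finrank ℝ (fluctKer F k K Vk))) ℝ) (hA : IsUnit A.det)
    (N : Matrix (FluctIdx F k K) (Fin (Module.finrank ℝ (fluctKer F k K Vk))) ℝ) (hN : N = recordCop F k K Vk * A) (hNN : Nᵀ * N = 1)
    (hpos : ((recordCop F k K Vk)ᵀ * recordS F k K εbg U Vk hopLin * recordCop F k K Vk).PosDef) :
    recordLogZkCan F k K εbg U Vk hopLin = Real.log ((recordJacQ F k K Vk)⁻¹ * B12Eq15QuadraticForm.Z14 (recordS F k K εbg U Vk hopLin) N) := by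
  rw [recordLogZkCan, recordZkCan_eq_coarea_of_orthonormal F k K εbg U Vk hopLin A hA N hN hNN hpos]

end Summit.QuantumFields.YangMills.Theorems.BalabanUVNodesPortS1

end
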